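import Summits.Ventures.PercRepro.Night2LocalS6Defs
import Summits.Ventures.PercRepro.Night2LocalSimpleCount
import Summits.Ventures.PercRepro.Night2LocalFiveThreeMod

/-!
# PercRepro — the S6 rows of the 3-element layer-0 members (night-2, gen 9)

A layer-`0` member `B` with three elements at a rank-`4` flat `G` with `|E ∖ G| = 2` spreads its `5/12` over the
`|G| − 4` sets `B ∪ (G ∖ cl B) ∪ {x}`, `x ∈ cl B ∖ B`: they are shadow sets at `G`, pairwise distinct, and they
are all the sets of that shape, so the row sum is exactly `5/12`.
-/

namespace PercRepro.Shadow

open Finset PerFlat ThmH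

variable {α : Type*} [DecidableEq α] {M : Matroid α} [M.Finite]

/-- The spread sets of a member `B` at `G`: `B ∪ (G ∖ cl B) ∪ {x}` for `x ∈ cl B ∖ B`. -/
noncomputable def spreadSets (M : Matroid α) [M.Finite] (B G : Finset α) : Finset (Finset α) :=
  (clF M B \ B).image (fun x => insert x (B ∪ (G \ clF M B)))

/-- A spread set of a member is a shadow set at `G` (it contains a covering set, which already has closure `G`). -/
theorem spreadSets_subset_shadowAt {q : ℕ} {𝒜 : Finset (Finset α)} (h𝒜 : 𝒜 ⊆ Uq M (q + 2) q) {G : Finset α}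
    (hG : G ∈ flatsQ M (q + 1)) {B : Finset α} (hB : B ∈ membersIn M 𝒜 G) (hm : (G \ clF M B).card = 1) :
    spreadSets M B G ⊆ shadowAt M (q + 2) q 𝒜 G := by
  intro S hS
  unfold spreadSets at hS
  rw [Finset.mem_image] at hS
  obtain ⟨x, hx, rfl⟩ := hS
  obtain ⟨z, hz⟩ := Finset.card_eq_one.1 hm
  have hzmem : z ∈ G \ clF M B := hz ▸ Finset.mem_singleton_self z
  -- the covering set `insert z B` is a shadow set at `G`
  have hcov : insert z B ∈ shadowAt M (q + 2) q 𝒜 G :=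
    coverSets_subset_shadowAt h𝒜 hG hB (by
      unfold coverSets; rw [Finset.mem_image]; exact ⟨z, hzmem, rfl⟩)
  rw [mem_shadowAt, mem_shadow] at hcov ⊢
  have hGg : G ⊆ gr M := (mem_flatsQ.1 hG).1
  have hclB : clF M B ⊆ G := (mem_membersIn.1 hB).2
  have hxG : x ∈ G := hclB (Finset.mem_sdiff.1 hx).1
  have hBg : B ⊆ gr M := (mem_Uq.1 (h𝒜 (mem_membersIn.1 hB).1)).1
  have hsub : insert z B ⊆ insert x (B ∪ (G \ clF M B)) := by
    intro e he
    rw [Finset.mem_insert] at he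
    rw [Finset.mem_insert, Finset.mem_union]
    rcases he with rfl | he
    · right; right; exact hzmem
    · right; left; exact he
  have hSG : insert x (B ∪ (G \ clF M B)) ⊆ G := by
    intro e he
    rw [Finset.mem_insert, Finset.mem_union] at he
    rcases he with rfl | he | he
    · exact hxG
    · exact hclB (subset_clF_of_subset_gr (hclB.trans hGg |> fun _ => hBg) he)
    · exact (Finset.mem_sdiff.1 he).1
  obtain ⟨⟨hY, -⟩, hcl⟩ := hcov
  refine ⟨⟨?_, ⟨B, (mem_membersIn.1 hB).1, (Finset.subset_insert _ _).trans hsub⟩⟩, ?_⟩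
  · -- the middle-set condition
    unfold Yq at hY ⊢
    rw [Finset.mem_filter, Finset.mem_powerset] at hY ⊢
    refine ⟨hSG.trans hGg, ?_, ?_⟩
    · exact lt_of_lt_of_le hY.2.1 (M.eRk_mono (by exact_mod_cast hsub))
    · have h1 : M.eRk ((insert x (B ∪ (G \ clF M B)) : Finset α) : Set α) ≤ M.eRk (G : Set α) :=
        M.eRk_mono (by exact_mod_cast hSG)
      rw [(mem_flatsQ.1 hG).2.2] at h1
      exact lt_of_le_of_lt h1 (by exact_mod_cast (by omega : q + 1 < q + 2))
  · apply le_antisymm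
    · exact (clF_mono hSG).trans (clF_subset_self_of_mem_flatsQ hG)
    · have h := clF_mono (M := M) hsub
      rwa [hcl] at h

/-- The spread sets are as many as the elements of `cl B ∖ B`. -/
theorem card_spreadSets (B G : Finset α) : (spreadSets M B G).card = (clF M B \ B).card := by
  unfold spreadSets
  apply Finset.card_image_of_injOn
  intro x hx x' hx' hxx'
  simp only [Finset.coe_sdiff, Set.mem_sdiff, Finset.mem_coe] at hx hx'
  have hxT : x ∉ B ∪ (G \ clF M B) := by
    rw [Finset.mem_union, Finset.mem_sdiff]; tauto
  have hxx'' : insert x (B ∪ (G \ clF M B)) = insert x' (B ∪ (G \ clF M B)) := hxx'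
  have h : x ∈ insert x' (B ∪ (G \ clF M B)) := by
    rw [← hxx'']; exact Finset.mem_insert_self x _
  rw [Finset.mem_insert] at h
  rcases h with h | h
  · exact h
  · exact absurd h hxT

/-- A spread set `S` of a layer-`0` member satisfies `B ∪ (G ∖ cl B) ⊆ S ⊆ G` and `|S ∖ B| = 2`. -/
theorem spread_pred_of_mem_spreadSets {G : Finset α} (hG : G ∈ flatsQ M 4) {B : Finset α} (hBg : B ⊆ gr M)
    (hclB : clF M B ⊆ G) (hm : (G \ clF M B).card = 1) {S : Finset α} (hS : S ∈ spreadSets M B G) :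
    B ∪ (G \ clF M B) ⊆ S ∧ S ⊆ G ∧ (S \ B).card = 2 := by
  unfold spreadSets at hS
  rw [Finset.mem_image] at hS
  obtain ⟨x, hx, rfl⟩ := hS
  rw [Finset.mem_sdiff] at hx
  have hGg : G ⊆ gr M := (mem_flatsQ.1 hG).1
  refine ⟨Finset.subset_insert _ _, ?_, ?_⟩
  · intro e he
    rw [Finset.mem_insert, Finset.mem_union] at he
    rcases he with rfl | he | he
    · exact hclB hx.1
    · exact hclB (subset_clF_of_subset_gr hBg he)
    · exact (Finset.mem_sdiff.1 he).1
  · have hBcl : B ⊆ clF M B := subset_clF_of_subset_gr hBg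
    have heq : insert x (B ∪ (G \ clF M B)) \ B = insert x (G \ clF M B) := by
      ext e
      simp only [Finset.mem_sdiff, Finset.mem_insert, Finset.mem_union]
      constructor
      · rintro ⟨h | h | h, hne⟩
        · exact Or.inl h
        · exact absurd h hne
        · exact Or.inr h
      · rintro (rfl | h)
        · exact ⟨Or.inl rfl, hx.2⟩
        · exact ⟨Or.inr (Or.inr h), fun hB => h.2 (hBcl hB)⟩
    rw [heq, Finset.card_insert_of_notMem (fun h => (Finset.mem_sdiff.1 h).2 hx.1), hm]

/-- Conversely, a set `S ⊆ G` with `B ∪ (G ∖ cl B) ⊆ S` and `|S ∖ B| = 2` is a spread set. -/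
theorem mem_spreadSets_of_pred {G B : Finset α} (hBg : B ⊆ gr M)
    (hm : (G \ clF M B).card = 1) {S : Finset α}
    (hpred : B ∪ (G \ clF M B) ⊆ S ∧ S ⊆ G ∧ (S \ B).card = 2) : S ∈ spreadSets M B G := by
  obtain ⟨hsub, hSG, hcard⟩ := hpred
  obtain ⟨z, hz⟩ := Finset.card_eq_one.1 hm
  have hzmem : z ∈ G \ clF M B := hz ▸ Finset.mem_singleton_self z
  have hBcl : B ⊆ clF M B := subset_clF_of_subset_gr hBg
  have hzB : z ∉ B := fun h => (Finset.mem_sdiff.1 hzmem).2 (hBcl h)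
  have hzS : z ∈ S \ B := Finset.mem_sdiff.2 ⟨hsub (Finset.mem_union_right _ hzmem), hzB⟩
  obtain ⟨a, b, hab, hab'⟩ := Finset.card_eq_two.1 hcard
  -- the other element `x` of `S ∖ B`
  have key : ∃ x, x ≠ z ∧ S \ B = {z, x} := by
    rw [hab'] at hzS ⊢
    rw [Finset.mem_insert, Finset.mem_singleton] at hzS
    rcases hzS with rfl | rfl
    · exact ⟨b, fun h => hab h.symm, rfl⟩
    · exact ⟨a, hab, Finset.pair_comm _ _⟩
  obtain ⟨x, hxz, hSB⟩ := key
  have hxS : x ∈ S \ B := hSB ▸ Finset.mem_insert_of_mem (Finset.mem_singleton_self x)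
  rw [Finset.mem_sdiff] at hxS
  have hxcl : x ∈ clF M B := by
    by_contra h
    have : x ∈ G \ clF M B := Finset.mem_sdiff.2 ⟨hSG hxS.1, h⟩
    rw [hz, Finset.mem_singleton] at this
    exact hxz this
  unfold spreadSets
  rw [Finset.mem_image]
  refine ⟨x, Finset.mem_sdiff.2 ⟨hxcl, hxS.2⟩, ?_⟩
  ext e
  rw [Finset.mem_insert, Finset.mem_union]
  constructor
  · rintro (rfl | he | he)
    · exact hxS.1
    · exact hsub (Finset.mem_union_left _ he)
    · exact hsub (Finset.mem_union_right _ he)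
  · intro he
    by_cases heB : e ∈ B
    · exact Or.inr (Or.inl heB)
    · have : e ∈ S \ B := Finset.mem_sdiff.2 ⟨he, heB⟩
      rw [hSB, Finset.mem_insert, Finset.mem_singleton] at this
      rcases this with rfl | rfl
      · exact Or.inr (Or.inr hzmem)
      · exact Or.inl rfl

/-- The shadow sets at `G` with the spread predicate are exactly the spread sets. -/
theorem filter_spread_eq_spreadSets {𝒜 : Finset (Finset α)} (h𝒜 : 𝒜 ⊆ Uq M 5 3) {G : Finset α}
    (hG : G ∈ flatsQ M 4) {B : Finset α} (hB : B ∈ membersIn M 𝒜 G) (hm : (G \ clF M B).card = 1) :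
    (shadowAt M 5 3 𝒜 G).filter (fun S => B ∪ (G \ clF M B) ⊆ S ∧ S ⊆ G ∧ (S \ B).card = 2) =
      spreadSets M B G := by
  have hBg : B ⊆ gr M := (mem_Uq.1 (h𝒜 (mem_membersIn.1 hB).1)).1
  have hclB : clF M B ⊆ G := (mem_membersIn.1 hB).2
  ext S
  rw [Finset.mem_filter]
  constructor
  · rintro ⟨-, hpred⟩
    exact mem_spreadSets_of_pred hBg hm hpred
  · intro hS
    exact ⟨spreadSets_subset_shadowAt (q := 3) h𝒜 hG hB hm hS, spread_pred_of_mem_spreadSets hG hBg hclB hm hS⟩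

/-- `|cl B ∖ B| = |G| − 4` for a `3`-element member with `|G ∖ cl B| = 1`. -/
theorem card_clF_sdiff_of_card_three {G B : Finset α} (hBg : B ⊆ gr M) (hclB : clF M B ⊆ G)
    (hm : (G \ clF M B).card = 1) (h3 : B.card = 3) : (clF M B \ B).card = G.card - 4 := by
  have h1 := Finset.card_sdiff_add_card_eq_card hclB
  have h2 := Finset.card_sdiff_add_card_eq_card (subset_clF_of_subset_gr hBg : B ⊆ clF M B)
  omega

open scoped Classical in
/-- **Row sum of a `3`-element layer-`0` member** (`q = 3`): exactly `5/12`. -/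
theorem sum_s6W_of_eq_one_of_card_three {𝒜 : Finset (Finset α)} (h𝒜 : 𝒜 ⊆ Uq M 5 3) {G : Finset α}
    (hG : G ∈ flatsQ M 4) (h5 : 5 ≤ G.card) {B : Finset α} (hB : B ∈ membersIn M 𝒜 G)
    (hm : (G \ clF M B).card = 1) (h3 : B.card = 3) :
    ∑ S ∈ shadowAt M 5 3 𝒜 G, s6W M G B S = 5 / 12 := by
  have hBg : B ⊆ gr M := (mem_Uq.1 (h𝒜 (mem_membersIn.1 hB).1)).1
  have hclB : clF M B ⊆ G := (mem_membersIn.1 hB).2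
  have hrow : ∀ S ∈ shadowAt M 5 3 𝒜 G, s6W M G B S =
      if B ∪ (G \ clF M B) ⊆ S ∧ S ⊆ G ∧ (S \ B).card = 2 then (5 / 12) / ((G.card - 4 : ℕ) : ℚ) else 0 := by
    intro S _
    unfold s6W
    rw [if_pos hm, if_pos h3]
  rw [Finset.sum_congr rfl hrow, ← Finset.sum_filter, filter_spread_eq_spreadSets h𝒜 hG hB hm,
    Finset.sum_const, card_spreadSets, card_clF_sdiff_of_card_three hBg hclB hm h3, nsmul_eq_mul]
  have hpos : (0 : ℚ) < ((G.card - 4 : ℕ) : ℚ) := by exact_mod_cast (by omega : 0 < G.card - 4)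
  field_simp

/-- `|cl B ∖ B| = |G| − 1 − |B|` for a member with `|G ∖ cl B| = 1`. -/
theorem card_clF_sdiff_of_eq_one {G B : Finset α} (hBg : B ⊆ gr M) (hclB : clF M B ⊆ G)
    (hm : (G \ clF M B).card = 1) : (clF M B \ B).card = G.card - 1 - B.card := by
  have h1 := Finset.card_sdiff_add_card_eq_card hclB
  have h2 := Finset.card_sdiff_add_card_eq_card (subset_clF_of_subset_gr hBg : B ⊆ clF M B)
  omega

open scoped Classical in
/-- The covering-set part of a layer-`0` row sums to the weight on the single covering set. -/
theorem sum_ite_coverSets_of_eq_one {q : ℕ} {𝒜 : Finset (Finset α)} (h𝒜 : 𝒜 ⊆ Uq M (q + 2) q)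
    {G : Finset α} (hG : G ∈ flatsQ M (q + 1)) {B : Finset α} (hB : B ∈ membersIn M 𝒜 G)
    (hm : (G \ clF M B).card = 1) (c : ℚ) :
    ∑ S ∈ shadowAt M (q + 2) q 𝒜 G, (if S ∈ coverSets M B G then c else 0) = c := by
  have hBU : B ∈ Uq M (q + 2) q := h𝒜 (mem_membersIn.1 hB).1
  have hsub := coverSets_subset_shadowAt h𝒜 hG hB
  rw [← Finset.sum_filter, Finset.filter_mem_eq_inter, Finset.inter_eq_right.2 hsub, Finset.sum_const,
    card_coverSets hBU, hm]
  simp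

open scoped Classical in
/-- **Row sum of a `4`-element layer-`0` member** (`q = 3`): exactly `5/12` in both branches of the rule. -/
theorem sum_s6W_of_eq_one_of_card_four {𝒜 : Finset (Finset α)} (h𝒜 : 𝒜 ⊆ Uq M 5 3) {G : Finset α}
    (hG : G ∈ flatsQ M 4) (h6 : 6 ≤ G.card) {B : Finset α} (hB : B ∈ membersIn M 𝒜 G)
    (hm : (G \ clF M B).card = 1) (h4 : B.card = 4) :
    ∑ S ∈ shadowAt M 5 3 𝒜 G, s6W M G B S = 5 / 12 := by
  have hBg : B ⊆ gr M := (mem_Uq.1 (h𝒜 (mem_membersIn.1 hB).1)).1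
  have hclB : clF M B ⊆ G := (mem_membersIn.1 hB).2
  by_cases hcond : B.card = 4 ∧ ∃ e ∈ B, rkN M (B.erase e) = 2 ∧ (clF M B \ clF M (B.erase e)).card ≤ 3
  · have hrow : ∀ S ∈ shadowAt M 5 3 𝒜 G, s6W M G B S =
        (if S ∈ coverSets M B G then 5 / 24 else 0) +
          (if B ∪ (G \ clF M B) ⊆ S ∧ S ⊆ G ∧ (S \ B).card = 2 then (5 / 24) / ((G.card - 5 : ℕ) : ℚ) else 0) := by
      intro S _
      unfold s6W
      rw [if_pos hm, if_neg (by omega), if_pos hcond]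
    rw [Finset.sum_congr rfl hrow, Finset.sum_add_distrib, sum_ite_coverSets_of_eq_one (q := 3) h𝒜 hG hB hm,
      ← Finset.sum_filter, filter_spread_eq_spreadSets h𝒜 hG hB hm, Finset.sum_const, card_spreadSets,
      card_clF_sdiff_of_eq_one hBg hclB hm, h4, nsmul_eq_mul]
    have hpos : (0 : ℚ) < ((G.card - 1 - 4 : ℕ) : ℚ) := by exact_mod_cast (by omega : 0 < G.card - 1 - 4)
    have hcast : ((G.card - 1 - 4 : ℕ) : ℚ) = ((G.card - 5 : ℕ) : ℚ) := by congr 1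
    rw [hcast] at hpos ⊢
    field_simp
    ring
  · have hrow : ∀ S ∈ shadowAt M 5 3 𝒜 G, s6W M G B S = if S ∈ coverSets M B G then 5 / 12 else 0 := by
      intro S _
      unfold s6W
      rw [if_pos hm, if_neg (by omega), if_neg hcond]
    rw [Finset.sum_congr rfl hrow, sum_ite_coverSets_of_eq_one (q := 3) h𝒜 hG hB hm]

/-! ## All rows, support, and the reduction of the type `(2, 1)` to the S6 column bound -/

open scoped Classical in
/-- **Every row of S6 is exact** (`q = 3`, `|E ∖ G| = 2`, `|G| ≥ 6`): the weights of a member `B` sum to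
`(5/4)·localWeight M B G`. -/
theorem sum_s6W_row {G : Finset α} (hG : G ∈ flatsQ M 4) (hd : (gr M \ G).card = 2) (h6 : 6 ≤ G.card)
    {B : Finset α} (hB : B ∈ membersIn M (Uq M 5 3) G) :
    ∑ S ∈ shadowAt M 5 3 (Uq M 5 3) G, s6W M G B S = (5 / 4) * localWeight M B G := by
  have hBU : B ∈ Uq M 5 3 := (mem_membersIn.1 hB).1
  have hclB : clF M B ⊆ G := (mem_membersIn.1 hB).2
  have hlw : localWeight M B G = ((G \ clF M B).card : ℚ) / (((G \ clF M B).card : ℚ) + 2) := by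
    unfold localWeight
    rw [card_compl_clF_add (q := 3) hG hclB, hd]
    push_cast
    ring
  rw [hlw]
  by_cases hm : (G \ clF M B).card = 1
  · rw [hm]
    have hB3 : 3 ≤ B.card := by
      have h1 : rkN M B = 3 := by
        unfold rkN; rw [(mem_Uq.1 hBU).2.1]; rfl
      have := rkN_le_card (M := M) B
      omega
    rcases Nat.lt_or_ge B.card 4 with h3 | h4
    · rw [sum_s6W_of_eq_one_of_card_three (Finset.Subset.refl _) hG (by omega) hB hm (by omega)]
      norm_num
    · rcases Nat.lt_or_ge B.card 5 with h4' | h5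
      · rw [sum_s6W_of_eq_one_of_card_four (Finset.Subset.refl _) hG h6 hB hm (by omega)]
        norm_num
      · rw [sum_s6W_of_eq_one_of_five_le (q := 3) (Finset.Subset.refl _) hG hB hm h5]
        norm_num
  · exact sum_s6W_of_ne_one (q := 3) (Finset.Subset.refl _) hG hB hm

open scoped Classical in
/-- A nonzero S6 weight `w(B, S)` has `B ⊆ S`. -/
theorem subset_of_s6W_ne_zero {G B S : Finset α} (h : s6W M G B S ≠ 0) : B ⊆ S := by
  unfold s6W at h
  have hcov : S ∈ coverSets M B G → B ⊆ S := by
    intro hS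
    obtain ⟨z, -, rfl⟩ := mem_coverSets.1 hS
    exact Finset.subset_insert _ _
  split_ifs at h with h1 h2 h3 h4 h5 h6 h7 h8 <;> first
    | exact absurd rfl h
    | exact (Finset.subset_union_left).trans ‹B ∪ (G \ clF M B) ⊆ S ∧ S ⊆ G ∧ (S \ B).card = 2›.1
    | exact hcov ‹S ∈ coverSets M B G›
    | skip
  all_goals first
    | exact hcov ‹S ∈ coverSets M B G›
    | exact (Finset.subset_union_left).trans ‹B ∪ (G \ clF M B) ⊆ S ∧ S ⊆ G ∧ (S \ B).card = 2›.1
    | exact absurd (by simp) h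

open scoped Classical in
/-- **The type `(2, 1)` local form follows from the S6 column bound**: if every shadow set at `G` carries S6 load
`≤ 1`, then `LocalShadowHall M 3 G` (`|E ∖ G| = 2`, `|G| ≥ 6`). -/
theorem localShadowHall_of_s6W_columns {G : Finset α} (hG : G ∈ flatsQ M 4) (hd : (gr M \ G).card = 2)
    (h6 : 6 ≤ G.card)
    (hcol : ∀ S ∈ shadowAt M 5 3 (Uq M 5 3) G, ∑ B ∈ membersIn M (Uq M 5 3) G, s6W M G B S ≤ 1) :
    LocalShadowHall M 3 G := by
  apply localShadowHall_of_full_matching (s6W M G)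
  · exact fun B S => s6W_nonneg G B S
  · exact fun B S h => subset_of_s6W_ne_zero h
  · exact hcol
  · intro B hB
    rw [sum_s6W_row hG hd h6 hB]
    norm_num

open scoped Classical in
/-- **The `(5, 3)` diagonal shadow form modulo the S6 column bound at the type-`(2, 1)` flats.** -/
theorem shadowHall_five_three_of_s6W_columns (hl : ∀ e ∈ gr M, M.IsNonloop e)
    (hrk : M.eRk ((gr M : Finset α) : Set α) = ((5 : ℕ) : ℕ∞))
    (hcol : ∀ G ∈ flatsQ M 4, (gr M \ G).card = 2 →
      (∃ B ∈ membersIn M (Uq M 5 3) G, (G \ clF M B).card = 1) → 6 ≤ G.card →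
      ∀ S ∈ shadowAt M 5 3 (Uq M 5 3) G, ∑ B ∈ membersIn M (Uq M 5 3) G, s6W M G B S ≤ 1) :
    ShadowHall M 5 3 (((3 : ℕ) + 2 : ℚ) / ((3 : ℕ) + 1 : ℚ)) := by
  apply shadowHall_five_three_of_two_one hl hrk
  intro G hG hd hex
  have h6 : 6 ≤ G.card := by
    obtain ⟨B, hB, -⟩ := hex
    have hBU : B ∈ Uq M 5 3 := (mem_membersIn.1 hB).1
    have hclB : clF M B ⊆ G := (mem_membersIn.1 hB).2
    have hBg : B ⊆ gr M := (mem_Uq.1 hBU).1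
    -- `|E ∖ B| ≥ 5` since `ρ(E ∖ B) = 5`, and `E ∖ B ⊆ (G ∖ B) ∪ (E ∖ G)`
    have h5 : 5 ≤ (gr M \ B).card := by
      have h := rkN_le_card (M := M) (gr M \ B)
      have h' : rkN M (gr M \ B) = 5 := by unfold rkN; rw [(mem_Uq.1 hBU).2.2]; rfl
      omega
    have hsplit : (gr M \ B).card ≤ (G \ B).card + (gr M \ G).card := by
      calc (gr M \ B).card ≤ ((G \ B) ∪ (gr M \ G)).card := Finset.card_le_card (by
            intro e he
            rw [Finset.mem_sdiff] at he
            rw [Finset.mem_union, Finset.mem_sdiff, Finset.mem_sdiff]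
            by_cases heG : e ∈ G
            · exact Or.inl ⟨heG, he.2⟩
            · exact Or.inr ⟨he.1, heG⟩)
        _ ≤ (G \ B).card + (gr M \ G).card := Finset.card_union_le _ _
    have hBG : B ⊆ G := (subset_clF_of_subset_gr hBg).trans hclB
    have h3 : 3 ≤ B.card := by
      have h1 : rkN M B = 3 := by unfold rkN; rw [(mem_Uq.1 hBU).2.1]; rfl
      have := rkN_le_card (M := M) B
      omega
    have := Finset.card_sdiff_add_card_eq_card hBG
    omega
  exact localShadowHall_of_s6W_columns hG hd h6 (hcol G hG hd hex h6)

end PercRepro.Shadow
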